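import Summits.ValiantsHypothesis.ValiantsHypothesis.Theorems.SymPencilPerFourHyperplanePencilRankOneA
import Summits.ValiantsHypothesis.ValiantsHypothesis.Theorems.SymPencilPerFourHyperplanePencilPerm

/-!
# Route `SymPencil` — the one-row pencil core of hyperplane flow rigidity, II-B: the rank-one
# lemma (tool file, `--supports` stmt-ValiantsHypothesis-5674; nothing here bears on `VP ≠ VNP`)

The RANK-ONE LEMMA of stub S1c (memo `Cruxes/SdcSuperquadratic/CELL-TWELVE-FOUR.md` §5 (4)), in
the exact form consumed by `SymPencilPerFourHyperplanePencilOrders.exists_kernel_hyperplane_of_X₂_eq_zero`: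

  `exists_rankOne_of_selfAdjoint_sq_zero`: if `μ ≠ 0`, `A² = 0` and
  `per [𝟙; A a; b; c] = per [𝟙; a; A b; c]` for all `a, b` and all `c ∈ ker μ`, then
  `A a = φ(a) • w` for a fixed vector `w` and a linear form `φ`.

Proof.  The image of `A` is isotropic for the net `T(·,·,c) = per [𝟙; ·; ·; c]`, `c ∈ ker μ`.  If
it contained two independent vectors `w, w'`: when all `μ(e_p)` are equal this is Case B of part A;
otherwise some `μ(e_q) ≠ μ(e_0)` and the vector `v ∈ span(w, w')` with `v_0 = v_q` has
`T(v,v,e_p) ∝ μ(e_p)` with the proportionality constant killed by `T(v,v,e_0) − T(v,v,e_q) =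
∓2(v_0 − v_q)(…) = 0`, so `v` is a node `e_i` of the Cayley cubic (`pair` case); with `e_i ∈ im A`
a second image vector `u` with `u_i = 0` is forced (cross isotropy) to be another node `e_z` with
`μ(e_i) = μ(e_z) = 0`, and the per₂ kill of part A ends it.  All index normalisations are done by
transporting `A ↦ P_σ A P_σ⁻¹` along a coordinate permutation `σ`
(`SymPencilPerFourHyperplanePencilPerm`).  Corollary `exists_kernel_hyperplane_of_X₂_eq_zero`: S1c holds
modulo `X₂ = 0` on `ker μ`.
Elementary. [folklore]
-/

-- single-conjunct layout: Sub = Summit, duplicated namespace component intended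
set_option linter.dupNamespace false

namespace Summit.ValiantsHypothesis.ValiantsHypothesis.Theorems.SymPencilPerFourHyperplanePencilRankOneB

open Matrix
open Summit.ValiantsHypothesis.ValiantsHypothesis.Theorems.SymPencilPerFourInnerRankRows
  (permanent_of_rows)
open Summit.ValiantsHypothesis.ValiantsHypothesis.Theorems.SymPencilPerFourBoxInjective
  (apply_eq_dotProduct)
open Summit.ValiantsHypothesis.ValiantsHypothesis.Theorems.SymPencilPerFourHyperplanePencilOrders
  (per_swap₁₂)
open Summit.ValiantsHypothesis.ValiantsHypothesis.Theorems.SymPencilPerFourHyperplanePencilRankOneA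
open Summit.ValiantsHypothesis.ValiantsHypothesis.Theorems.SymPencilPerFourHyperplanePencilPerm

variable {K : Type*} [Field K] [CharZero K]

/-! ### The node case: `e₀ ∈ im A` -/

/-- **Node case**: a self-adjoint square-zero `A` with `e₀ = A b₀` has its image on the line `K e₀`.
[folklore] -/
theorem false_of_single₀_mem_range (μ : (Fin 4 → K) →ₗ[K] K)
    (A : (Fin 4 → K) →ₗ[K] (Fin 4 → K))
    (hsa : ∀ a b c : Fin 4 → K, μ c = 0 →
      (Matrix.of ![(fun _ => (1 : K)), A a, b, c]).permanent =
        (Matrix.of ![(fun _ => (1 : K)), a, A b, c]).permanent)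
    (hsq : ∀ a, A (A a) = 0) (b₀ b₁ : Fin 4 → K) (h0 : A b₀ = Pi.single 0 1)
    (hind : ∀ t : K, A b₁ ≠ t • Pi.single 0 1) : False := by
  -- the second image vector `u`, `u 0 = 0`, `u ≠ 0`
  obtain ⟨u, hu⟩ : ∃ u : Fin 4 → K, u = A b₁ - (A b₁ 0) • Pi.single 0 1 := ⟨_, rfl⟩
  have huA : u = A (b₁ - (A b₁ 0) • b₀) := by rw [hu, map_sub, map_smul, h0]
  have hu0 : u 0 = 0 := by rw [hu]; simp
  have hune : u ≠ 0 := fun h => hind (A b₁ 0) (by rw [h] at hu; exact sub_eq_zero.1 hu.symm)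
  have hu_of : u 1 = 0 → u 2 = 0 → u 3 = 0 → False := fun h1 h2 h3 =>
    hune (by funext p; fin_cases p <;> simp [hu0, h1, h2, h3])
  have hiso : ∀ x y c : Fin 4 → K, μ c = 0 →
      (Matrix.of ![(fun _ => (1 : K)), A x, A y, c]).permanent = 0 := fun x y c hc => by
    rw [hsa x (A y) c hc, hsq]
    simp only [permanent_of_rows, Pi.zero_apply]; ring
  -- cross isotropy `T(u, e₀, c) = 0` and self isotropy `T(u, u, c) = 0` on `ker μ`
  obtain ⟨t', ht'⟩ := exists_coeff_of_vanish μ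
    (fun p => (Matrix.of ![(fun _ => (1 : K)), u, Pi.single 0 1, Pi.single p 1]).permanent)
    fun c hc => by
      have h := hiso b₀ (b₁ - (A b₁ 0) • b₀) c hc
      rw [h0, ← huA, per_swap₁₂, per_last_eq_dotProduct] at h
      exact h
  obtain ⟨t'', ht''⟩ := exists_coeff_of_vanish μ
    (fun p => (Matrix.of ![(fun _ => (1 : K)), u, u, Pi.single p 1]).permanent)
    fun c hc => by
      have h := hiso (b₁ - (A b₁ 0) • b₀) (b₁ - (A b₁ 0) • b₀) c hc
      rw [← huA, per_last_eq_dotProduct] at h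
      exact h
  have c0 : (0 : K) = t' * μ (Pi.single 0 1) := by
    have h := ht' 0; rw [per_single_single, if_pos rfl] at h; exact h
  have c1 : u 2 + u 3 = t' * μ (Pi.single 1 1) := by
    have h := ht' 1; rw [per_single_single, if_neg (by decide)] at h; linear_combination h
  have c2 : u 1 + u 3 = t' * μ (Pi.single 2 1) := by
    have h := ht' 2; rw [per_single_single, if_neg (by decide)] at h; linear_combination h
  have c3 : u 1 + u 2 = t' * μ (Pi.single 3 1) := by
    have h := ht' 3; rw [per_single_single, if_neg (by decide)] at h; linear_combination h
  have s0 : 2 * (u 1 * u 2 + u 1 * u 3 + u 2 * u 3) = t'' * μ (Pi.single 0 1) := by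
    have h := ht'' 0; rw [per_self_single₀] at h; exact h
  have s1 : 2 * (u 2 * u 3) = t'' * μ (Pi.single 1 1) := by
    have h := ht'' 1; rw [per_self_single₁, hu0] at h; linear_combination h
  have s2 : 2 * (u 1 * u 3) = t'' * μ (Pi.single 2 1) := by
    have h := ht'' 2; rw [per_self_single₂, hu0] at h; linear_combination h
  have s3 : 2 * (u 1 * u 2) = t'' * μ (Pi.single 3 1) := by
    have h := ht'' 3; rw [per_self_single₃, hu0] at h; linear_combination h
  -- a node `e_z ∈ im A` (`z ≠ 0`) is excluded by the per₂ kill after the transport `swap 1 z`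
  have node : ∀ z : Fin 4, z ≠ 0 → (∀ p, p ≠ z → u p = 0) → u z ≠ 0 → False := by
    intro z hz hp huz
    have hez : A ((u z)⁻¹ • (b₁ - (A b₁ 0) • b₀)) = Pi.single z 1 := by
      rw [map_smul, ← huA]
      funext p
      rw [Pi.smul_apply, smul_eq_mul, Pi.single_apply]
      by_cases hpz : p = z
      · rw [if_pos hpz, hpz, inv_mul_cancel₀ huz]
      · rw [if_neg hpz, hp p hpz, mul_zero]
    have hσ0 : (Equiv.swap (1 : Fin 4) z).symm 0 = 0 := by
      rw [Equiv.symm_swap, Equiv.swap_apply_of_ne_of_ne (by decide) hz.symm]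
    have hσz : (Equiv.swap (1 : Fin 4) z).symm z = 1 := by
      rw [Equiv.symm_swap, Equiv.swap_apply_right]
    refine false_of_single₀_single₁_mem_range
      (μ ∘ₗ LinearMap.funLeft K K (Equiv.swap (1 : Fin 4) z).symm)
      (LinearMap.funLeft K K (Equiv.swap (1 : Fin 4) z) ∘ₗ A ∘ₗ
        LinearMap.funLeft K K (Equiv.swap (1 : Fin 4) z).symm)
      (selfAdjoint_conj _ μ A hsa) (sq_conj _ A hsq) (b₀ ∘ (Equiv.swap (1 : Fin 4) z))
      (((u z)⁻¹ • (b₁ - (A b₁ 0) • b₀)) ∘ (Equiv.swap (1 : Fin 4) z)) ?_ ?_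
    · rw [conj_apply, comp_comp_symm, h0, single_comp_perm, hσ0]
    · rw [conj_apply, comp_comp_symm, hez, single_comp_perm, hσz]
  -- two of `u 1, u 2, u 3` vanishing forces a node
  have two : u 2 * u 3 = 0 → u 1 * u 3 = 0 → u 1 * u 2 = 0 → False := fun p23 p13 p12 => by
    by_cases h1 : u 1 = 0
    · by_cases h2 : u 2 = 0
      · refine node 3 (by decide) (fun p hp => ?_) (fun h3 => hu_of h1 h2 h3)
        fin_cases p
        · exact hu0
        · exact h1
        · exact h2
        · exact absurd rfl hp
      · have h3 : u 3 = 0 := by simpa [h2] using p23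
        refine node 2 (by decide) (fun p hp => ?_) h2
        fin_cases p
        · exact hu0
        · exact h1
        · exact absurd rfl hp
        · exact h3
    · have h2 : u 2 = 0 := by simpa [h1] using p12
      have h3 : u 3 = 0 := by simpa [h1] using p13
      refine node 1 (by decide) (fun p hp => ?_) h1
      fin_cases p
      · exact hu0
      · exact absurd rfl hp
      · exact h2
      · exact h3
  by_cases hm0 : μ (Pi.single 0 1) = 0
  · -- `μ(e₀) = 0`: `e₂(u) = 0` and the `N`-analysis
    rw [hm0, mul_zero] at s0
    have ht'ne : t' ≠ 0 := by
      rintro rfl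
      rw [zero_mul] at c1 c2 c3
      exact hu_of (by linear_combination (c2 + c3 - c1) / 2)
        (by linear_combination (c1 + c3 - c2) / 2) (by linear_combination (c1 + c2 - c3) / 2)
    -- `t' · 2 u_j u_k = t'' (u_j + u_k)`
    have k1 : t' * (2 * (u 2 * u 3)) = t'' * (u 2 + u 3) := by
      linear_combination t' * s1 - t'' * c1
    have k2 : t' * (2 * (u 1 * u 3)) = t'' * (u 1 + u 3) := by
      linear_combination t' * s2 - t'' * c2
    have k3 : t' * (2 * (u 1 * u 2)) = t'' * (u 1 + u 2) := by
      linear_combination t' * s3 - t'' * c3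
    have hsum : t'' * (u 1 + u 2 + u 3) = 0 := by
      linear_combination (-(k1 + k2 + k3) + t' * s0) / 2
    have prod : t'' = 0 → False := fun ht'' => by
      rw [ht'', zero_mul] at k1 k2 k3
      refine two ?_ ?_ ?_
      · have := mul_eq_zero.1 k1; simpa [ht'ne] using this
      · have := mul_eq_zero.1 k2; simpa [ht'ne] using this
      · have := mul_eq_zero.1 k3; simpa [ht'ne] using this
    rcases mul_eq_zero.1 hsum with ht'' | hE
    · exact prod ht''
    · by_cases ht'' : t'' = 0
      · exact prod ht''
      · have q1 : t' * (2 * (u 2 * u 3)) = -(t'' * u 1) := by linear_combination k1 + t'' * hE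
        have q2 : t' * (2 * (u 1 * u 3)) = -(t'' * u 2) := by linear_combination k2 + t'' * hE
        have q3 : t' * (2 * (u 1 * u 2)) = -(t'' * u 3) := by linear_combination k3 + t'' * hE
        have hx : u 1 ≠ 0 := by
          intro h1
          have h2 : t'' * u 2 = 0 := by linear_combination q2 - 2 * t' * u 3 * h1
          have h2' : u 2 = 0 := by simpa [ht''] using h2
          exact hu_of h1 h2' (by linear_combination hE - h1 - h2')
        have hz : u 3 ≠ 0 := by
          intro h3
          have : t'' * u 1 = 0 := by linear_combination q1 - 2 * t' * u 2 * h3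
          exact hx (by simpa [ht''] using this)
        have hy : u 2 ≠ 0 := by
          intro h2
          have : t'' * u 3 = 0 := by linear_combination q3 - 2 * t' * u 1 * h2
          exact hz (by simpa [ht''] using this)
        have e21 : (t' * (2 * u 3)) * ((u 2 - u 1) * (u 2 + u 1)) = 0 := by
          linear_combination u 2 * q1 - u 1 * q2
        have e31 : (t' * (2 * u 2)) * ((u 3 - u 1) * (u 3 + u 1)) = 0 := by
          linear_combination u 3 * q1 - u 1 * q3
        have e21' : (u 2 - u 1) * (u 2 + u 1) = 0 := by
          rcases mul_eq_zero.1 e21 with h | h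
          · exfalso; simp [ht'ne, hz] at h
          · exact h
        have e31' : (u 3 - u 1) * (u 3 + u 1) = 0 := by
          rcases mul_eq_zero.1 e31 with h | h
          · exfalso; simp [ht'ne, hy] at h
          · exact h
        rcases mul_eq_zero.1 e21' with h2 | h2 <;> rcases mul_eq_zero.1 e31' with h3 | h3
        · exact hx (by linear_combination (hE - h2 - h3) / 3)
        · exact hx (by linear_combination hE - h2 - h3)
        · exact hx (by linear_combination hE - h2 - h3)
        · exact hx (by linear_combination -(hE - h2 - h3))
  · -- `μ(e₀) ≠ 0`: `t' = 0`, `u = 0`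
    have ht' : t' = 0 := by
      rcases mul_eq_zero.1 c0.symm with h | h
      · exact h
      · exact absurd h hm0
    rw [ht', zero_mul] at c1 c2 c3
    exact hu_of (by linear_combination (c2 + c3 - c1) / 2)
      (by linear_combination (c1 + c3 - c2) / 2) (by linear_combination (c1 + c2 - c3) / 2)

/-! ### Isotropy of the image -/

omit [CharZero K] in
/-- The image of a self-adjoint square-zero `A` is isotropic: `T(Ax, Ay, c) = 0` on `ker μ`.
[folklore] -/
theorem per_range_range_eq_zero (μ : (Fin 4 → K) →ₗ[K] K) (A : (Fin 4 → K) →ₗ[K] (Fin 4 → K))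
    (hsa : ∀ a b c : Fin 4 → K, μ c = 0 →
      (Matrix.of ![(fun _ => (1 : K)), A a, b, c]).permanent =
        (Matrix.of ![(fun _ => (1 : K)), a, A b, c]).permanent)
    (hsq : ∀ a, A (A a) = 0) (x y c : Fin 4 → K) (hc : μ c = 0) :
    (Matrix.of ![(fun _ => (1 : K)), A x, A y, c]).permanent = 0 := by
  rw [hsa x (A y) c hc, hsq]
  simp only [permanent_of_rows, Pi.zero_apply]; ring

/-! ### The pair case: `μ(e₀) ≠ μ(e₁)` -/

/-- **Pair case**: if `μ(e₀) ≠ μ(e₁)` and the (isotropic) image of `A` contains two independent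
vectors, then it contains the node `e₂` or the node `e₃`. [folklore] -/
theorem exists_single_mem_range_of_ne (μ : (Fin 4 → K) →ₗ[K] K)
    (A : (Fin 4 → K) →ₗ[K] (Fin 4 → K))
    (hiso : ∀ x y c : Fin 4 → K, μ c = 0 →
      (Matrix.of ![(fun _ => (1 : K)), A x, A y, c]).permanent = 0)
    (hm : μ (Pi.single 0 1) ≠ μ (Pi.single 1 1)) (b₀ b₁ : Fin 4 → K) (hw : A b₀ ≠ 0)
    (hind : ∀ t : K, A b₁ ≠ t • A b₀) :
    (∃ a, A a = Pi.single 2 1) ∨ (∃ a, A a = Pi.single 3 1) := by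
  -- an image vector `v ≠ 0` with `v 0 = v 1`
  have hv : ∃ bv : Fin 4 → K, A bv ≠ 0 ∧ A bv 0 = A bv 1 := by
    by_cases hd : A b₀ 0 - A b₀ 1 = 0
    · exact ⟨b₀, hw, sub_eq_zero.1 hd⟩
    · refine ⟨(A b₁ 0 - A b₁ 1) • b₀ - (A b₀ 0 - A b₀ 1) • b₁, fun h => ?_, ?_⟩
      · rw [map_sub, map_smul, map_smul, sub_eq_zero] at h
        apply hind ((A b₁ 0 - A b₁ 1) / (A b₀ 0 - A b₀ 1))
        rw [div_eq_inv_mul, ← smul_smul, h, smul_smul, inv_mul_cancel₀ hd, one_smul]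
      · simp only [map_sub, map_smul, Pi.sub_apply, Pi.smul_apply, smul_eq_mul]; ring
  obtain ⟨bv, hv0, hv01⟩ := hv
  obtain ⟨t, ht⟩ := exists_coeff_of_vanish μ
    (fun p => (Matrix.of ![(fun _ => (1 : K)), A bv, A bv, Pi.single p 1]).permanent)
    fun c hc => by have h := hiso bv bv c hc; rw [per_last_eq_dotProduct] at h; exact h
  have f0 := ht 0; have f1 := ht 1
  simp only [per_self_single₀, per_self_single₁] at f0 f1
  have ht0 : t = 0 := by
    have h : t * (μ (Pi.single 0 1) - μ (Pi.single 1 1)) = 0 := by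
      linear_combination -(f0 - f1) - 2 * (A bv 2 + A bv 3) * hv01
    exact (mul_eq_zero.1 h).resolve_right (sub_ne_zero.2 hm)
  have g : ∀ p, (Matrix.of ![(fun _ => (1 : K)), A bv, A bv, Pi.single p 1]).permanent = 0 :=
    fun p => by rw [ht p, ht0, zero_mul]
  have hvz : ∀ h0 : A bv 0 = 0, ∀ h1 : A bv 1 = 0, ∀ h2 : A bv 2 = 0, ∀ h3 : A bv 3 = 0, False :=
    fun h0 h1 h2 h3 => hv0 (by funext p; fin_cases p <;> assumption)
  rcases node_of_per_self_eq_zero (A bv) (g 0) (g 1) (g 2) (g 3) with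
    ⟨h1, h2, h3⟩ | ⟨h0, h2, h3⟩ | ⟨h0, h1, h3⟩ | ⟨h0, h1, h2⟩
  · exact (hvz (hv01.trans h1) h1 h2 h3).elim
  · exact (hvz h0 (hv01.symm.trans h0) h2 h3).elim
  · left
    have hv2 : A bv 2 ≠ 0 := fun h2 => hvz h0 h1 h2 h3
    refine ⟨(A bv 2)⁻¹ • bv, ?_⟩
    rw [map_smul]; funext p
    fin_cases p <;> simp [h0, h1, h3, inv_mul_cancel₀ hv2]
  · right
    have hv3 : A bv 3 ≠ 0 := fun h3 => hvz h0 h1 h2 h3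
    refine ⟨(A bv 3)⁻¹ • bv, ?_⟩
    rw [map_smul]; funext p
    fin_cases p <;> simp [h0, h1, h2, inv_mul_cancel₀ hv3]

/-! ### The rank-one lemma -/

/-- **The rank-one lemma** (memo §5 (4), hypothesis `hrank` of
`SymPencilPerFourHyperplanePencilOrders.exists_kernel_hyperplane_of_X₂_eq_zero`): a square-zero
linear map of `K⁴` which is self-adjoint for every `T(·,·,c) = per [𝟙; ·; ·; c]`, `c ∈ ker μ`,
has rank `≤ 1` (for `μ = 0` as well). [folklore] -/
theorem exists_rankOne_of_selfAdjoint_sq_zero (μ : (Fin 4 → K) →ₗ[K] K)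
    (A : (Fin 4 → K) →ₗ[K] (Fin 4 → K))
    (hsa : ∀ a b c : Fin 4 → K, μ c = 0 →
      (Matrix.of ![(fun _ => (1 : K)), A a, b, c]).permanent =
        (Matrix.of ![(fun _ => (1 : K)), a, A b, c]).permanent)
    (hsq : ∀ a, A (A a) = 0) :
    ∃ (w : Fin 4 → K) (φ : (Fin 4 → K) →ₗ[K] K), ∀ a, A a = φ a • w := by
  have hiso := per_range_range_eq_zero μ A hsa hsq
  by_cases hA : ∀ a, A a = 0
  · exact ⟨0, 0, fun a => by rw [hA a, LinearMap.zero_apply, zero_smul]⟩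
  push Not at hA; obtain ⟨b₀, hb₀⟩ := hA
  -- every image vector is a multiple of `A b₀`
  have claim : ∀ a, ∃ t : K, A a = t • A b₀ := by
    intro a; by_contra hna; push Not at hna
    -- (1) a node `e_i` in the image
    have hnode : ∃ i : Fin 4, ∃ b, A b = Pi.single i 1 := by
      by_cases hall : μ (Pi.single 1 1) = μ (Pi.single 0 1) ∧
          μ (Pi.single 2 1) = μ (Pi.single 0 1) ∧ μ (Pi.single 3 1) = μ (Pi.single 0 1)
      · exfalso
        refine false_of_isotropic_pair_const μ (μ (Pi.single 0 1)) (fun p => ?_) (A b₀) (A a)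
          hb₀ hna fun α β c hc => ?_
        · fin_cases p
          · rfl
          · exact hall.1
          · exact hall.2.1
          · exact hall.2.2
        · have h := hiso (α • b₀ + β • a) (α • b₀ + β • a) c hc
          rwa [map_add, map_smul, map_smul] at h
      · have hq : ∃ q : Fin 4, q ≠ 0 ∧ μ (Pi.single q 1) ≠ μ (Pi.single 0 1) := by
          by_contra hc; push Not at hc
          exact hall ⟨hc 1 (by decide), hc 2 (by decide), hc 3 (by decide)⟩
        obtain ⟨q, hq0, hq⟩ := hq
        -- transport by `σ = swap 1 q` and the pair case
        have hσ0 : (Equiv.swap (1 : Fin 4) q) 0 = 0 :=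
          Equiv.swap_apply_of_ne_of_ne (by decide) hq0.symm
        have hσ1 : (Equiv.swap (1 : Fin 4) q) 1 = q := Equiv.swap_apply_left _ _
        have hm' : (μ ∘ₗ LinearMap.funLeft K K (Equiv.swap (1 : Fin 4) q).symm) (Pi.single 0 1) ≠
            (μ ∘ₗ LinearMap.funLeft K K (Equiv.swap (1 : Fin 4) q).symm) (Pi.single 1 1) := by
          rw [conj_single, conj_single, hσ0, hσ1]; exact hq.symm
        have hw' : (LinearMap.funLeft K K (Equiv.swap (1 : Fin 4) q) ∘ₗ A ∘ₗ
            LinearMap.funLeft K K (Equiv.swap (1 : Fin 4) q).symm)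
            (b₀ ∘ (Equiv.swap (1 : Fin 4) q)) ≠ 0 := by
          rw [conj_apply, comp_comp_symm]
          intro h; apply hb₀
          rw [← comp_comp_symm (Equiv.swap (1 : Fin 4) q) (A b₀), h]; rfl
        have hind' : ∀ t : K, (LinearMap.funLeft K K (Equiv.swap (1 : Fin 4) q) ∘ₗ A ∘ₗ
            LinearMap.funLeft K K (Equiv.swap (1 : Fin 4) q).symm) (a ∘ (Equiv.swap (1 : Fin 4) q)) ≠
            t • (LinearMap.funLeft K K (Equiv.swap (1 : Fin 4) q) ∘ₗ A ∘ₗ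
              LinearMap.funLeft K K (Equiv.swap (1 : Fin 4) q).symm)
              (b₀ ∘ (Equiv.swap (1 : Fin 4) q)) := by
          intro t h
          rw [conj_apply, conj_apply, comp_comp_symm, comp_comp_symm] at h
          apply hna t
          rw [← comp_comp_symm (Equiv.swap (1 : Fin 4) q) (A a), h]
          funext p; simp
        rcases exists_single_mem_range_of_ne _ _
            (per_range_range_eq_zero _ _ (selfAdjoint_conj _ μ A hsa) (sq_conj _ A hsq)) hm' _ _
            hw' hind' with ⟨a', ha'⟩ | ⟨a', ha'⟩
        · refine ⟨Equiv.swap (1 : Fin 4) q 2, a' ∘ (Equiv.swap (1 : Fin 4) q).symm, ?_⟩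
          rw [conj_apply] at ha'
          rw [← comp_comp_symm (Equiv.swap (1 : Fin 4) q) (A (a' ∘ _)), ha', single_comp_perm]
          simp
        · refine ⟨Equiv.swap (1 : Fin 4) q 3, a' ∘ (Equiv.swap (1 : Fin 4) q).symm, ?_⟩
          rw [conj_apply] at ha'
          rw [← comp_comp_symm (Equiv.swap (1 : Fin 4) q) (A (a' ∘ _)), ha', single_comp_perm]
          simp
    obtain ⟨i, b, hb⟩ := hnode
    -- (2) an image vector off the line `K e_i`
    have hoff : ∃ a', ∀ t : K, A a' ≠ t • Pi.single i 1 := by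
      by_cases hi : ∃ t₀ : K, A b₀ = t₀ • Pi.single i 1
      · obtain ⟨t₀, ht₀⟩ := hi
        have ht₀ne : t₀ ≠ 0 := by rintro rfl; exact hb₀ (by rw [ht₀, zero_smul])
        refine ⟨a, fun t h => hna (t / t₀) ?_⟩
        rw [h, ht₀, smul_smul, div_mul_cancel₀ _ ht₀ne]
      · push Not at hi
        exact ⟨b₀, hi⟩
    obtain ⟨a', ha'⟩ := hoff
    -- (3) transport by `τ = swap 0 i` and the node case
    have hτi : (Equiv.swap (0 : Fin 4) i).symm i = 0 := by
      rw [Equiv.symm_swap, Equiv.swap_apply_right]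
    refine false_of_single₀_mem_range (μ ∘ₗ LinearMap.funLeft K K (Equiv.swap (0 : Fin 4) i).symm)
      (LinearMap.funLeft K K (Equiv.swap (0 : Fin 4) i) ∘ₗ A ∘ₗ
        LinearMap.funLeft K K (Equiv.swap (0 : Fin 4) i).symm)
      (selfAdjoint_conj _ μ A hsa) (sq_conj _ A hsq) (b ∘ Equiv.swap (0 : Fin 4) i)
      (a' ∘ Equiv.swap (0 : Fin 4) i) ?_ fun t h => ?_
    · rw [conj_apply, comp_comp_symm, hb, single_comp_perm, hτi]
    · rw [conj_apply, comp_comp_symm] at h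
      apply ha' t
      have hs : (Pi.single 0 (1 : K) : Fin 4 → K) ∘ (Equiv.swap (0 : Fin 4) i).symm =
          Pi.single i 1 := by
        rw [single_comp_perm, Equiv.symm_symm, Equiv.swap_apply_left]
      rw [← comp_comp_symm (Equiv.swap (0 : Fin 4) i) (A a'), h, ← hs]
      funext p; simp only [Function.comp_apply, Pi.smul_apply]
  -- the linear form
  obtain ⟨j, hj⟩ : ∃ j, A b₀ j ≠ 0 := by
    by_contra h; push Not at h; exact hb₀ (funext h)
  refine ⟨A b₀, (A b₀ j)⁻¹ • (LinearMap.proj j ∘ₗ A), fun a => ?_⟩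
  obtain ⟨t, ht⟩ := claim a
  rw [LinearMap.smul_apply, LinearMap.comp_apply, LinearMap.proj_apply, ht, Pi.smul_apply,
    smul_eq_mul, smul_eq_mul, ← mul_assoc, mul_comm _ t, mul_assoc, inv_mul_cancel₀ hj, mul_one]

/-- **S1c modulo `X₂ = 0`.**  The one-row pencil core of `RIG_𝟙` with the last-slot map vanishing
on the hyperplane: if `per [𝟙; a + tX₀a; b + tX₁b; c + tX₂c] = per [𝟙; a; b; c]` for all `a, b`,
all `c ∈ ker μ` and all `t`, and `X₂ = 0` on `ker μ`, then `X₀, X₁` vanish on a common hyperplane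
`ker φ` (or identically).  What remains of S1c: `X₂ = 0` on `ker μ` (memo §5 (2)–(3)). [folklore] -/
theorem exists_kernel_hyperplane_of_X₂_eq_zero (X₀ X₁ X₂ : (Fin 4 → K) →ₗ[K] (Fin 4 → K))
    (μ : (Fin 4 → K) →ₗ[K] K)
    (h : ∀ (a b c : Fin 4 → K) (t : K), μ c = 0 →
      (Matrix.of ![(fun _ => (1 : K)), a + t • X₀ a, b + t • X₁ b, c + t • X₂ c]).permanent =
        (Matrix.of ![(fun _ => (1 : K)), a, b, c]).permanent)
    (hZ : ∀ c, μ c = 0 → X₂ c = 0) :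
    ∃ φ : (Fin 4 → K) →ₗ[K] K,
      (∀ a, φ a = 0 → X₀ a = 0 ∧ X₁ a = 0) ∧ (∀ c, μ c = 0 → X₂ c = 0) :=
  SymPencilPerFourHyperplanePencilOrders.exists_kernel_hyperplane_of_X₂_eq_zero X₀ X₁ X₂ μ h hZ
    fun A hA hA2 => exists_rankOne_of_selfAdjoint_sq_zero μ A hA hA2

end Summit.ValiantsHypothesis.ValiantsHypothesis.Theorems.SymPencilPerFourHyperplanePencilRankOneB
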